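import Literature.AlgebraicGeometry.Motives.JacobianThetaDivisor
import Literature.AlgebraicGeometry.Motives.AbelianVarietyDimZeroProofs
import Literature.AlgebraicGeometry.Motives.CartierDivisorClassPullback
import HarnessLib

/-!
# (Z) `hdimX` — a Jacobian carrying a Riemann theta divisor has positive dimension

Pen letter (Z) of road G4 (cell `hodgecm-mathlib`): the transport head
`Jacobian.exists_open_ajSum_classPullback_translate_of_leaves` needs `1 ≤ dim J`, while (F-P2) carries this only for
`J_Y`; this file discharges it for ANY Jacobian carrying a Riemann theta divisor, so the final assembly is `hdim`-free.
-/

set_option autoImplicit false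

noncomputable section

universe u

open CategoryTheory AlgebraicGeometry

namespace Literature.AlgebraicGeometry.Motives

namespace Jacobian

variable {k : Type u} [Field k] {C : SchemeOver k} (𝒥 : Jacobian C)

/-- The Brill–Noether locus `W̃_r(P)` is non-empty: it contains the image of the tuple point `(P, …, P)` of `C^r` under
the Abel sum map. [cite: Lange2023AbelianVarietiesComplex, §4.2.1 Lemma 4.2.1] -/
theorem brillNoetherLocus_nonempty (P : AlgPoints C k) (r : ℕ) : (𝒥.brillNoetherLocus P r).Nonempty :=
  ⟨(𝒥.abelSum P r).left.base ((RelativeSpec.liftOver C.hom r fun _ => P).left.base (IsLocalRing.closedPoint k)),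
    𝒥.range_abelSum_subset_brillNoetherLocus P r ⟨_, rfl⟩⟩

variable {𝒥}

/-- **A Jacobian carrying a Riemann theta divisor has `1 ≤ dim J`.**  If `dim J = 0` then `J` is a single point
(★ `AbelianVariety.subsingleton_left_of_dim_eq_zero`), namely its generic point, at which every Cartier divisor is a unit
(★ `isUnitAt_genericPoint`); but the support `(Θ.nonvanishing 1)ᶜ = t_x(W̃_{g−1}(P))` of a Riemann theta divisor is
non-empty. [cite: Milne1986JacobianVarieties, §6 (Θ = W^{g-1}, before Thm. 6.6)] -/
theorem IsRiemannThetaDivisor.one_le_dim {Θ : CartierDivisor 𝒥.J.X.left} (h : 𝒥.IsRiemannThetaDivisor Θ) :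
    1 ≤ 𝒥.J.dim := by
  by_contra hlt
  have h0 : 𝒥.J.dim = 0 := by omega
  haveI := 𝒥.J.subsingleton_left_of_dim_eq_zero h0
  haveI : IsIntegral 𝒥.J.X.left := GeometricallyIntegral.isIntegral_of_subsingleton 𝒥.J.X.hom
  obtain ⟨-, P, x, hsupp⟩ := h
  obtain ⟨w, hw⟩ := 𝒥.brillNoetherLocus_nonempty P (𝒥.J.dim - 1)
  have hmem : (𝒥.J.translation x).left.base w ∈ (Θ.nonvanishing 1)ᶜ := by
    rw [hsupp]
    exact ⟨w, hw, rfl⟩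
  have hgen : genericPoint 𝒥.J.X.left ∈ Θ.nonvanishing 1 :=
    CartierDivisor.avoids_iff_mem_nonvanishing_one.mp fun i _ => RatFn.isUnitAt_genericPoint (Θ.f_ne_zero i)
  rw [Subsingleton.elim ((𝒥.J.translation x).left.base w) (genericPoint 𝒥.J.X.left)] at hmem
  exact hmem hgen

end Jacobian

end Literature.AlgebraicGeometry.Motives

end
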